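import Summits.RiemannHypothesis.RiemannHypothesis.Theses.ScrewLemmaKCoprofile
import Summits.RiemannHypothesis.RiemannHypothesis.Theorems.ScrewLemmaKCoprofileIsometryC1
import Summits.RiemannHypothesis.RiemannHypothesis.Theorems.ScrewLemmaKCoprofileCoprofileMoments
import Summits.RiemannHypothesis.RiemannHypothesis.Theorems.ScrewLemmaKCoprofileMomentGramFloor
import Summits.RiemannHypothesis.RiemannHypothesis.Theorems.ScrewLemmaKCoprofileAssembly
import HarnessLib

/-!
# Item `CoprofileIsometry` (K1, stmt-RiemannHypothesis-21612) of route ScrewLemmaKCoprofile — the closer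

`coprofileIsometry_proof : Summit.RiemannHypothesis.RiemannHypothesis.Theses.ScrewLemmaKCoprofile.CoprofileIsometry`
(the route decl BY NAME; shared crux r3 of route ScrewLemmaKExtremalRay): for every admissible generator `g`
(`C¹[0,1]`, `g(1) = 0`, `∫g = 0`, `∫g u^{-1/2} = 0`) whose profile deviation has `(h − h₀)²/y² ∈ L¹(0,1)`,

  `∫₀¹ (h − h₀)² y⁻² dy + h₀² = (4π²)⁻¹ ∫₀¹ (Σ_{n ≤ 1/t} g′(nt)/n)² dt`.

It is `ScrewLemmaKCoprofile.profile_isometry` (the `C¹` density theorem; the `u^{-1/2}`-moment is not used).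
Chain: exact Euler–Maclaurin (`ScrewLemmaKProfileBernoulli`), `C²` plateau bound and Mellin convergence
(`…Defs`, `…C2`), Müntz + IBP (`…Muentz`), continuation (`…Continuation`), functional-equation modulus
(`ScrewLemmaKCoprofileZetaReflect`), Mellin–Plancherel at `σ = −½` and the `C²` isometry (`…Parseval`), co-profile
Parseval (`ScrewLemmaKCoprofileMellin`, item 22439), density (`ScrewLemmaKCoprofileDensity{Approx,Limit}`,
`…IsometryC1`).  Mathematics: rh-idea-5 g0 (desk, family «LEMMA K♯»), SKETCH-21612-K1.md; Lean port and density step: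
rh-split-prover-l17 with k1-w3 / k1 g0 (tree files as cited).

With K2 (`coprofileMoments_proof`), K3 (`momentGramFloor_proof`) and the Assembly (`assembly_proof`) already in the
tree, the route's deciding theorem `Theses.ScrewLemmaKCoprofile.closes` then yields the rung leaf itself:
`screwSmoothSectorKSharp : IntegerScrew.ScrewSmoothSectorKSharp` — LEMMA K with the sharp constant `π² − 1`
(rung S-P(P1) of the SCREW column; the last decl of rh-idea-5's v6 file, verbatim up to the K1 name).

This closes a crux and the leaf of an RH-free real-analysis rung (Lemma K♯ of the SCREW column); it is NOT a proof
of RH and nothing here bears on the truth of RH.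
-/

noncomputable section

set_option linter.dupNamespace false

namespace Summit.RiemannHypothesis.RiemannHypothesis.Theorems.ScrewLemmaKCoprofile

open MeasureTheory Set
open Summit.RiemannHypothesis.RiemannHypothesis.Theorems.IntegerScrew (SmoothSectorAdmissible latticeProfile
  latticePlateau)

/-- **Item `CoprofileIsometry` (K1, stmt-RiemannHypothesis-21612)**, the route decl by name: for admissible `g`
with `(h − h₀)²/y²` integrable on `(0,1)`, `∫₀¹ (h − h₀)² y⁻² dy + h₀² = (4π²)⁻¹ ∫₀¹ Φ_g²`.  RH-free. [folklore] -/
theorem coprofileIsometry_proof :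
    Summit.RiemannHypothesis.RiemannHypothesis.Theses.ScrewLemmaKCoprofile.CoprofileIsometry := by
  unfold Summit.RiemannHypothesis.RiemannHypothesis.Theses.ScrewLemmaKCoprofile.CoprofileIsometry
  intro g hg hint
  exact profile_isometry hg.1 hg.2.1 hg.2.2.1 hint

/-- **LEMMA K♯ (rung S-P(P1)) — `ScrewSmoothSectorKSharp`**: for every admissible generator whose profile deviation has
`(h − h₀)²/y² ∈ L¹(0,1)`, `(π² − 1)·h₀² ≤ ∫₀¹ (h − h₀)² y⁻² dy`; via the route's deciding theorem
`ScrewLemmaKCoprofile.closes` with K1 (this file), K2, K3 and the Assembly (tree).  RH-free. [folklore] -/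
theorem screwSmoothSectorKSharp :
    Summit.RiemannHypothesis.RiemannHypothesis.Theorems.IntegerScrew.ScrewSmoothSectorKSharp :=
  Summit.RiemannHypothesis.RiemannHypothesis.Theses.ScrewLemmaKCoprofile.closes
    coprofileIsometry_proof coprofileMoments_proof momentGramFloor_proof assembly_proof

end Summit.RiemannHypothesis.RiemannHypothesis.Theorems.ScrewLemmaKCoprofile

end
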